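import Summits.QuantumFields.YangMills.Theorems.LuscherReductionOneSiteLevelsAbsLowerPrep
import Summits.QuantumFields.YangMills.Theorems.LuscherReductionOneSiteLevelsValleyReduction
import Summits.QuantumFields.YangMills.Theorems.LuscherReductionRunningReductionInnerCopiesForm
import Summits.QuantumFields.YangMills.Theorems.LuscherReductionTwistedTraceScalingOneSiteNearTopPrelim
import HarnessLib

/-!
# One twist copy of a gnomonic pull-back: the all-upper hemisphere pattern, its twist sum, support radius and chart integrals
# (rate-twin input of the FLOOR WITH RATE of `stub_boRate`; seat `ym-line-ftr-p1` g9; part 2 of 4 of the concentrated one-site quasimode)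

Crux ONE's trial states `Ψ = G ∘ gnCoord μ` (`…OneSiteLevelsGnPullback`, seat ym-luscher-20007-p2) are invariant under the eight centre flips (the gnomonic
coordinate is antipodal-invariant), i.e. they live on all `8` hemisphere patterns at once.  The Born–Oppenheimer door with rate needs a ONE-SITE amplitude supported in
ONE twist copy of the vacuum (gauge = `Ad`-invariant, not flip-invariant), so we restrict to the all-upper pattern `{U | ∀ e, 0 < scalarPart (U e)}`:
`φ = 𝟙_+ · Ψ`.  This file is the bookkeeping of that restriction (ns `…FemtoTransferGap.Quasimode`):
* §1 `measurableSet_upper`, `scalarPart_gnChart`, ★ `upper_gnChart_iff` (a chart point is all-upper iff its pattern is trivial), `measure_exists_scalarPart_eq_zero`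
  (the equator set is null), ★ `sum_indicator_upper_twist3` (for a generic configuration exactly one of the eight flips is all-upper), ★ `twistSum_indicator_upper_ae_eq`
  (`twistSum (𝟙_+ Ψ) = Ψ` a.e. for physical `Ψ`), `qform_congr_ae`, `l2_congr_ae`;
* §2 `abs_vecPart_le_of_upper`, ★ `orbitDist_le_of_upper` (`orbitDist U ≤ 6√3·μ·‖gnCoord μ U‖` on the all-upper pattern), `norm_zmCoord_gnChart_sq_le`
  (`‖zmCoord 1 (gnChart μ σ y)‖² ≤ μ²‖y‖²`);
* §3 ★ `l2_indicator_upper_gnPullback` (`‖𝟙_+Ψ_G‖² = ∫ρG²`), ★ `integral_zmCoord_sq_mul_indicator_upper_le` (`∫‖zmCoord 1‖²(𝟙_+Ψ_G)² ≤ μ²·μ⁹(2π²)⁻³·∫‖y‖²G²`).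
Sequel: `…OneSiteQuasimodeCore` (the Rayleigh / norm / moment estimates), `…OneSiteQuasimode` (the quasimode).
HONEST FRAMING: a one-site (finite-dimensional) computation over crux ONE's landed analysis; an input of the RATE twin of RED lane A's C4-CORE for the femto rung
R2b1 (RECORD label) — route `FlatTubeReduction`, crux K1 `NearFlatRatioLaw` stmt-QuantumFields-24720 / FCL `FixedLatticeLaw` 23943; not infinite volume, not a mass gap,
not Clay.  No new definitions, no named facts, no `sorry`.
-/

set_option autoImplicit false

noncomputable section

open MeasureTheory Filter Topology Real
open scoped Matrix ENNReal BigOperators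
open Literature.MathematicalPhysics.QuantumFieldTheory
open Literature.MathematicalPhysics.QuantumLattice
open Literature.Analysis.OperatorTheory.YMMatrixModel

namespace Summit.QuantumFields.YangMills.Theorems.FemtoTransferGap

namespace Quasimode

/-! ## §1 The all-upper hemisphere pattern and the twist copies -/

/-- The all-upper pattern set `{U | ∀ e, 0 < scalarPart (U e)}` is measurable. [folklore] -/
theorem measurableSet_upper : MeasurableSet {U : Cfg | ∀ e : Edge 3 1, 0 < scalarPart (U e)} := by
  haveI : SecondCountableTopology SU2 := secondCountableTopology_su2
  have h : {U : Cfg | ∀ e : Edge 3 1, 0 < scalarPart (U e)} = ⋂ e : Edge 3 1, (fun U : Cfg => scalarPart (U e)) ⁻¹' Set.Ioi 0 := by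
    ext U; simp
  rw [h]
  exact MeasurableSet.iInter fun e => (continuous_scalarPart.measurable.comp (measurable_pi_apply e)) measurableSet_Ioi

/-- Scalar parts of the chart links: `scalarPart (gnChart μ σ y e) = ± scalarPart (gnoPoint (μ y_{e.2}))` according to the bit `σ e.2`. [folklore] -/
theorem scalarPart_gnChart (μ : ℝ) (σ : Fin 3 → Bool) (y : ZM) (e : Edge 3 1) :
    scalarPart (gnChart μ σ y e) =
      (if σ e.2 then -1 else 1) * scalarPart (Literature.MathematicalPhysics.QuantumFieldTheory.Balaban1983to89.T4CubeChartGnomonic.gnoPoint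
        (fun a => μ * y (e.2, a))) := by
  show scalarPart (hemi (σ e.2) * _) = _
  rcases Bool.eq_false_or_eq_true (σ e.2) with h | h
  · rw [h]; simp [hemi, scalarPart_negOne_mul]
  · rw [h]; simp [hemi]

/-- The chart links never lie on the equator. [folklore] -/
theorem scalarPart_gnChart_ne_zero (μ : ℝ) (σ : Fin 3 → Bool) (y : ZM) (e : Edge 3 1) : scalarPart (gnChart μ σ y e) ≠ 0 := by
  rw [scalarPart_gnChart]
  have hp := scalarPart_gnoPoint_pos (fun a => μ * y (e.2, a))
  split_ifs <;> · intro h; nlinarith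

/-- A chart point is all-upper iff its pattern is the trivial one. [folklore] -/
theorem upper_gnChart_iff (μ : ℝ) (σ : Fin 3 → Bool) (y : ZM) :
    (∀ e : Edge 3 1, 0 < scalarPart (gnChart μ σ y e)) ↔ σ = fun _ => false := by
  constructor
  · intro h
    funext i
    have hi := h (edgeOf i)
    rw [scalarPart_gnChart] at hi
    have hp := scalarPart_gnoPoint_pos (fun a => μ * y ((edgeOf i).2, a))
    by_contra hne
    have ht : σ i = true := by cases hσ : σ i <;> simp_all
    have : σ (edgeOf i).2 = true := by simpa [edgeOf] using ht
    rw [if_pos this] at hi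
    nlinarith
  · rintro rfl e
    rw [scalarPart_gnChart]
    simp only [Bool.false_eq_true, ↓reduceIte, one_mul]
    exact scalarPart_gnoPoint_pos _

/-- The non-generic set `{∃ e, scalarPart (U e) = 0}` is null for the one-site a-priori measure (it misses every gnomonic chart). [folklore] -/
theorem measure_exists_scalarPart_eq_zero :
    configMeasure SU2 1 {U : Cfg | ∃ e : Edge 3 1, scalarPart (U e) = 0} = 0 := by
  haveI : SecondCountableTopology SU2 := secondCountableTopology_su2
  have hS : MeasurableSet {U : Cfg | ∃ e : Edge 3 1, scalarPart (U e) = 0} := by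
    have h : {U : Cfg | ∃ e : Edge 3 1, scalarPart (U e) = 0} = ⋃ e : Edge 3 1, (fun U : Cfg => scalarPart (U e)) ⁻¹' {0} := by
      ext U; simp
    rw [h]
    exact MeasurableSet.iUnion fun e => (continuous_scalarPart.measurable.comp (measurable_pi_apply e)) (measurableSet_singleton 0)
  rw [configMeasure_su2_one_eq_sum_gnChart one_pos, Measure.sum_apply _ hS]
  simp only [ENNReal.tsum_eq_zero]
  intro σ
  rw [Measure.map_apply (measurable_gnChart 1 σ) hS]
  have hempty : gnChart 1 σ ⁻¹' {U : Cfg | ∃ e : Edge 3 1, scalarPart (U e) = 0} = ∅ := by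
    ext y
    simp only [Set.mem_preimage, Set.mem_setOf_eq, Set.mem_empty_iff_false, iff_false, not_exists]
    exact fun e => scalarPart_gnChart_ne_zero 1 σ y e
  rw [hempty, measure_empty]

/-- At one site every link is twisted: `twist3 z U e = centreElem (z e.2) · U e`. [folklore] -/
theorem twist3_apply_one (z : Fin 3 → Bool) (U : Cfg) (e : Edge 3 1) : TT.twist3 z U e = TT.centreElem (z e.2) * U e := by
  rw [TT.twist3_apply, if_pos (Subsingleton.elim _ _)]

/-- Scalar part of a twisted link: `scalarPart (centreElem b · W) = ∓ scalarPart W`. [folklore] -/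
theorem scalarPart_centreElem_mul (b : Bool) (W : SU2) : scalarPart (TT.centreElem b * W) = (if b then -1 else 1) * scalarPart W := by
  cases b
  · simp [TT.centreElem]
  · simp [TT.centreElem, scalarPart_negOne_mul]

/-- ★ For a GENERIC configuration (no link on the equator) exactly one of the eight twist copies is all-upper:
`Σ_z 𝟙{∀ e, 0 < scalarPart (twist3 z U e)} = 1`. [folklore] -/
theorem sum_indicator_upper_twist3 {U : Cfg} (hU : ∀ e : Edge 3 1, scalarPart (U e) ≠ 0) :
    ∑ z : Fin 3 → Bool, Set.indicator {V : Cfg | ∀ e : Edge 3 1, 0 < scalarPart (V e)} (fun _ => (1 : ℝ)) (TT.twist3 z U) = 1 := by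
  classical
  set z₀ : Fin 3 → Bool := fun i => decide (scalarPart (U (edgeOf i)) < 0) with hz₀
  rw [Finset.sum_eq_single z₀]
  · -- the copy `z₀` is all-upper
    have hmem : TT.twist3 z₀ U ∈ {V : Cfg | ∀ e : Edge 3 1, 0 < scalarPart (V e)} := by
      rw [Set.mem_setOf_eq]
      intro e
      rw [twist3_apply_one, scalarPart_centreElem_mul]
      have hUe : U e = U (edgeOf e.2) := by rw [edgeOf_snd]
      by_cases h : scalarPart (U (edgeOf e.2)) < 0
      · have : z₀ e.2 = true := by rw [hz₀]; exact decide_eq_true h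
        rw [if_pos this, hUe]; linarith
      · have : z₀ e.2 = false := by rw [hz₀]; exact decide_eq_false h
        rw [if_neg (by rw [this]; exact Bool.false_ne_true), one_mul]
        rcases lt_or_gt_of_ne (hU e) with h1 | h1
        · exact absurd (by rwa [hUe] at h1) h
        · exact h1
    rw [Set.indicator_of_mem hmem]
  · -- every other copy has a link in the lower hemisphere
    intro z _ hz
    rw [Set.indicator_of_notMem]
    rw [Set.mem_setOf_eq, not_forall]
    obtain ⟨i, hi⟩ := Function.ne_iff.1 hz
    refine ⟨edgeOf i, ?_⟩
    rw [twist3_apply_one, scalarPart_centreElem_mul]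
    show ¬ 0 < (if z (edgeOf i).2 = true then -1 else 1) * scalarPart (U (edgeOf i))
    have hi2 : (edgeOf i).2 = i := rfl
    rw [hi2]
    by_cases h : scalarPart (U (edgeOf i)) < 0
    · have h0 : z₀ i = true := by rw [hz₀]; exact decide_eq_true h
      have hz' : z i = false := by
        cases hzi : z i
        · rfl
        · exact absurd (hzi.trans h0.symm) hi
      rw [hz']; simp only [Bool.false_eq_true, ↓reduceIte, one_mul]; linarith
    · have h0 : z₀ i = false := by rw [hz₀]; exact decide_eq_false h
      have hz' : z i = true := by
        cases hzi : z i
        · exact absurd (hzi.trans h0.symm) hi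
        · rfl
      rw [hz']; simp only [↓reduceIte, neg_mul, one_mul, Left.neg_pos_iff, not_lt]
      exact le_of_not_gt h
  · intro h; exact absurd (Finset.mem_univ z₀) h

/-- ★ The twist sum of the all-upper restriction of a PHYSICAL (twist-invariant) function is the function itself, almost everywhere. [folklore] -/
theorem twistSum_indicator_upper_ae_eq {Ψ : Cfg → ℝ} (hΨ : IsPhys Ψ) :
    (twistSum (Set.indicator {V : Cfg | ∀ e : Edge 3 1, 0 < scalarPart (V e)} Ψ)) =ᵐ[configMeasure SU2 1] Ψ := by
  have hsub : {U : Cfg | twistSum (Set.indicator {V : Cfg | ∀ e : Edge 3 1, 0 < scalarPart (V e)} Ψ) U ≠ Ψ U} ⊆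
      {U : Cfg | ∃ e : Edge 3 1, scalarPart (U e) = 0} := by
    intro U hU
    rw [Set.mem_setOf_eq] at hU ⊢
    by_contra hne
    push Not at hne
    apply hU
    have hind : Set.indicator {V : Cfg | ∀ e : Edge 3 1, 0 < scalarPart (V e)} Ψ =
        fun V => Set.indicator {V : Cfg | ∀ e : Edge 3 1, 0 < scalarPart (V e)} (fun _ => (1 : ℝ)) V * Ψ V := by
      funext V
      by_cases hV : V ∈ {V : Cfg | ∀ e : Edge 3 1, 0 < scalarPart (V e)}
      · rw [Set.indicator_of_mem hV, Set.indicator_of_mem hV, one_mul]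
      · rw [Set.indicator_of_notMem hV, Set.indicator_of_notMem hV, zero_mul]
    rw [hind, twistSum_mul_of_isPhys _ hΨ, twistSum, sum_indicator_upper_twist3 hne, one_mul]
  exact measure_mono_null hsub measure_exists_scalarPart_eq_zero

/-- `qform` only sees the a.e. class of its argument. [folklore] -/
theorem qform_congr_ae {β : ℝ} {ψ ψ' : Cfg → ℝ} (h : ψ =ᵐ[configMeasure SU2 1] ψ') :
    qform su2Rep β ψ ψ = qform su2Rep β ψ' ψ' := by
  unfold qform
  refine integral_congr_ae ?_
  filter_upwards [h] with U hU
  rw [hU]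
  refine integral_congr_ae ?_
  filter_upwards [h] with V hV
  rw [hV]

/-- `l2` only sees the a.e. class of its argument. [folklore] -/
theorem l2_congr_ae {ψ ψ' : Cfg → ℝ} (h : ψ =ᵐ[configMeasure SU2 1] ψ') : l2 ψ ψ = l2 ψ' ψ' := by
  unfold l2
  refine integral_congr_ae ?_
  filter_upwards [h] with U hU
  rw [hU]

/-! ## §2 Geometry of the window: support radius and the second-moment weight in the chart -/

/-- In the all-upper pattern, the vector parts are bounded by the scaled gnomonic coordinate: `|vecPart (U e) a| ≤ μ‖gnCoord μ U‖` (`μ > 0`). [folklore] -/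
theorem abs_vecPart_le_of_upper {μ : ℝ} (hμ : 0 < μ) {U : Cfg} (hU : ∀ e : Edge 3 1, 0 < scalarPart (U e)) (e : Edge 3 1) (a : Fin 3) :
    |vecPart (U e) a| ≤ μ * ‖gnCoord μ U‖ := by
  have hs := hU e
  have hs1 : scalarPart (U e) ≤ 1 := (abs_le.mp (abs_scalarPart_le (U e))).2
  -- `|gnCoord μ U (e.2, a)| ≤ ‖gnCoord μ U‖`
  have hcoord : |gnCoord μ U (e.2, a)| ≤ ‖gnCoord μ U‖ := by
    rw [EuclideanSpace.norm_eq]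
    refine Real.abs_le_sqrt ?_
    have := Finset.single_le_sum (f := fun p : Fin 3 × Fin 3 => ‖gnCoord μ U p‖ ^ 2) (fun p _ => sq_nonneg _)
      (Finset.mem_univ (e.2, a))
    simpa only [Real.norm_eq_abs, sq_abs] using this
  have hval : gnCoord μ U (e.2, a) = vecPart (U e) a / scalarPart (U e) / μ := by
    rw [gnCoord_apply, gnLink_apply, edgeOf_snd]
  rw [hval, abs_div, abs_div, abs_of_pos hs, abs_of_pos hμ] at hcoord
  have h1 : |vecPart (U e) a| / scalarPart (U e) / μ ≤ ‖gnCoord μ U‖ := hcoord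
  rw [div_le_iff₀ hμ, div_le_iff₀ hs] at h1
  calc |vecPart (U e) a| ≤ ‖gnCoord μ U‖ * μ * scalarPart (U e) := h1
    _ ≤ ‖gnCoord μ U‖ * μ * 1 := mul_le_mul_of_nonneg_left hs1 (by positivity)
    _ = μ * ‖gnCoord μ U‖ := by ring

/-- ★ **Support radius**: an all-upper configuration with `‖gnCoord μ U‖ ≤ r` is within `6√3·μr` of the vacuum orbit: `orbitDist U ≤ 6√3·μ·r`. [folklore] -/
theorem orbitDist_le_of_upper {μ : ℝ} (hμ : 0 < μ) {U : Cfg} (hU : ∀ e : Edge 3 1, 0 < scalarPart (U e)) {r : ℝ} (hr : ‖gnCoord μ U‖ ≤ r) :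
    orbitDist U ≤ 6 * Real.sqrt 3 * μ * r := by
  have hr0 : 0 ≤ r := (norm_nonneg _).trans hr
  have hper : ∀ e : Edge 3 1, frobNorm (((U e : SU2) : Matrix (Fin 2) (Fin 2) ℂ) - 1) ≤ 2 * Real.sqrt 3 * μ * r := fun e => by
    have h1 := frobNorm_sub_one_sq_le_of_scalarPart_nonneg (hU e).le
    have h2 : ∑ a, vecPart (U e) a ^ 2 ≤ 3 * (μ * r) ^ 2 := by
      have ha : ∀ a, vecPart (U e) a ^ 2 ≤ (μ * r) ^ 2 := fun a => by
        rw [← sq_abs]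
        exact pow_le_pow_left₀ (abs_nonneg _) ((abs_vecPart_le_of_upper hμ hU e a).trans (mul_le_mul_of_nonneg_left hr hμ.le)) 2
      calc ∑ a, vecPart (U e) a ^ 2 ≤ ∑ _a : Fin 3, (μ * r) ^ 2 := Finset.sum_le_sum fun a _ => ha a
        _ = 3 * (μ * r) ^ 2 := by simp
    have h3 : frobNorm (((U e : SU2) : Matrix (Fin 2) (Fin 2) ℂ) - 1) ^ 2 ≤ (2 * Real.sqrt 3 * μ * r) ^ 2 := by
      have hs3 : Real.sqrt 3 ^ 2 = 3 := Real.sq_sqrt (by norm_num)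
      nlinarith
    exact (abs_le_of_sq_le_sq' h3 (by positivity)).2
  calc orbitDist U ≤ gaugeDist 1 U := orbitDist_le 1 _
    _ = ∑ e : Edge 3 1, frobNorm (((U e : SU2) : Matrix (Fin 2) (Fin 2) ℂ) - 1) := by
        unfold gaugeDist; simp only [TT.gaugeTransform_one']
    _ ≤ ∑ _e : Edge 3 1, 2 * Real.sqrt 3 * μ * r := Finset.sum_le_sum fun e _ => hper e
    _ = 6 * Real.sqrt 3 * μ * r := by simp; ring

/-- The second-moment weight in the chart: `‖zmCoord 1 (gnChart μ σ y)‖² ≤ μ²‖y‖²`. [folklore] -/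
theorem norm_zmCoord_gnChart_sq_le {μ : ℝ} (hμ : 0 < μ) (σ : Fin 3 → Bool) (y : ZM) :
    ‖zmCoord 1 (gnChart μ σ y)‖ ^ 2 ≤ μ ^ 2 * ‖y‖ ^ 2 := by
  rw [norm_zmCoord_one_sq, EuclideanSpace.norm_eq, Real.sq_sqrt (Finset.sum_nonneg fun _ _ => by positivity),
    Fintype.sum_prod_type, Finset.mul_sum]
  refine Finset.sum_le_sum fun i _ => ?_
  rw [Finset.mul_sum]
  refine Finset.sum_le_sum fun a _ => ?_
  -- the link `edgeOf i` of the chart point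
  have hlink : gnChart μ σ y (edgeOf i) = hemi (σ i) *
      Literature.MathematicalPhysics.QuantumFieldTheory.Balaban1983to89.T4CubeChartGnomonic.gnoPoint (fun b => μ * y (i, b)) := rfl
  have hvec : vecPart (gnChart μ σ y (edgeOf i)) a ^ 2 =
      vecPart (Literature.MathematicalPhysics.QuantumFieldTheory.Balaban1983to89.T4CubeChartGnomonic.gnoPoint (fun b => μ * y (i, b))) a ^ 2 := by
    rw [hlink]
    rcases hemi_eq (σ i) with h | h
    · rw [h, one_mul]
    · rw [h, vecPart_negOne_mul, Pi.neg_apply, neg_sq]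
  rw [hvec]
  -- `vecPart W a = scalarPart W · μ y(i,a)` with `0 < scalarPart W ≤ 1`
  have hgn := gnLink_gnoPoint (fun b => μ * y (i, b))
  have hsp := scalarPart_gnoPoint_pos (fun b => μ * y (i, b))
  have hs1 : scalarPart (Literature.MathematicalPhysics.QuantumFieldTheory.Balaban1983to89.T4CubeChartGnomonic.gnoPoint (fun b => μ * y (i, b))) ≤ 1 :=
    (abs_le.mp (abs_scalarPart_le _)).2
  have hva := congr_fun hgn a
  rw [gnLink_apply, div_eq_iff hsp.ne'] at hva
  -- `hva : vecPart W a = μ y(i,a) · scalarPart W`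
  rw [hva, Real.norm_eq_abs, sq_abs]
  have : scalarPart (Literature.MathematicalPhysics.QuantumFieldTheory.Balaban1983to89.T4CubeChartGnomonic.gnoPoint (fun b => μ * y (i, b))) ^ 2 ≤ 1 := by
    nlinarith
  calc (μ * y (i, a) * scalarPart (Literature.MathematicalPhysics.QuantumFieldTheory.Balaban1983to89.T4CubeChartGnomonic.gnoPoint (fun b => μ * y (i, b)))) ^ 2
      = scalarPart (Literature.MathematicalPhysics.QuantumFieldTheory.Balaban1983to89.T4CubeChartGnomonic.gnoPoint (fun b => μ * y (i, b))) ^ 2 *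
          (μ ^ 2 * y (i, a) ^ 2) := by ring
    _ ≤ 1 * (μ ^ 2 * y (i, a) ^ 2) := mul_le_mul_of_nonneg_right this (by positivity)
    _ = μ ^ 2 * y (i, a) ^ 2 := one_mul _

/-! ## §3 The one-copy restriction of a gnomonic pull-back: norm and second moment in the chart -/

/-- The all-upper restriction seen in the chart: only the trivial pattern survives. [folklore] -/
theorem indicator_upper_gnChart (μ : ℝ) (Ψ : Cfg → ℝ) (σ : Fin 3 → Bool) (y : ZM) :
    Set.indicator {V : Cfg | ∀ e : Edge 3 1, 0 < scalarPart (V e)} Ψ (gnChart μ σ y) =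
      if σ = fun _ => false then Ψ (gnChart μ σ y) else 0 := by
  by_cases h : σ = fun _ => false
  · have hmem : gnChart μ σ y ∈ {V : Cfg | ∀ e : Edge 3 1, 0 < scalarPart (V e)} := (upper_gnChart_iff μ σ y).2 h
    rw [if_pos h, Set.indicator_of_mem hmem]
  · have hnot : gnChart μ σ y ∉ {V : Cfg | ∀ e : Edge 3 1, 0 < scalarPart (V e)} := fun hmem => h ((upper_gnChart_iff μ σ y).1 hmem)
    rw [if_neg h, Set.indicator_of_notMem hnot]

/-- ★ **Norm of the one-copy restriction**: `‖𝟙_+ · (G ∘ gnCoord μ)‖² = ∫ ρ G²` (one eighth of `‖G ∘ gnCoord μ‖²`). [folklore] -/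
theorem l2_indicator_upper_gnPullback {μ : ℝ} (hμ : 0 < μ) {G : ZM → ℝ} (hG : Measurable G) (hb : ∃ C : ℝ, ∀ x, |G x| ≤ C) :
    l2 (Set.indicator {V : Cfg | ∀ e : Edge 3 1, 0 < scalarPart (V e)} (fun U : Cfg => G (gnCoord μ U)))
        (Set.indicator {V : Cfg | ∀ e : Edge 3 1, 0 < scalarPart (V e)} (fun U : Cfg => G (gnCoord μ U))) =
      ∫ y, gnDensityReal μ y * G y ^ 2 := by
  obtain ⟨C, hC⟩ := hb
  set φ := Set.indicator {V : Cfg | ∀ e : Edge 3 1, 0 < scalarPart (V e)} (fun U : Cfg => G (gnCoord μ U)) with hφ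
  have hφm : Measurable φ := (hG.comp (measurable_gnCoord μ)).indicator measurableSet_upper
  have hφb : ∀ U, |φ U| ≤ C := fun U => by
    rw [hφ, Set.indicator_apply]
    split_ifs
    · exact hC _
    · rw [abs_zero]; exact (abs_nonneg _).trans (hC 0)
  unfold l2
  rw [integral_configMeasure_eq_sum_gnChart hμ (show Measurable (fun U => φ U * φ U) from hφm.mul hφm) ⟨C * C, fun U => by
    rw [abs_mul]; exact mul_le_mul (hφb U) (hφb U) (abs_nonneg _) ((abs_nonneg _).trans (hφb U))⟩]
  rw [Finset.sum_eq_single (fun _ : Fin 3 => false)]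
  · refine integral_congr_ae (ae_of_all _ fun y => ?_)
    have h1 : φ (gnChart μ (fun _ => false) y) = G y := by
      rw [hφ, indicator_upper_gnChart μ, if_pos rfl, gnCoord_gnChart hμ.ne']
    show gnDensityReal μ y * (φ (gnChart μ (fun _ => false) y) * φ (gnChart μ (fun _ => false) y)) = gnDensityReal μ y * G y ^ 2
    rw [h1]; ring
  · intro σ _ hσ
    refine integral_eq_zero_of_ae (ae_of_all _ fun y => ?_)
    have h1 : φ (gnChart μ σ y) = 0 := by rw [hφ, indicator_upper_gnChart μ, if_neg hσ]
    show gnDensityReal μ y * (φ (gnChart μ σ y) * φ (gnChart μ σ y)) = (0 : ZM → ℝ) y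
    rw [h1, Pi.zero_apply]; ring
  · intro h; exact absurd (Finset.mem_univ _) h

/-- ★ **Second moment of the one-copy restriction**: `∫ ‖zmCoord 1 U‖² (𝟙_+ Ψ_G)(U)² dU ≤ μ²·μ⁹(2π²)⁻³·∫‖y‖²G²` (`G²`, `‖y‖²G²` integrable). [folklore] -/
theorem integral_zmCoord_sq_mul_indicator_upper_le {μ : ℝ} (hμ : 0 < μ) {G : ZM → ℝ} (hG : Measurable G) (hb : ∃ C : ℝ, ∀ x, |G x| ≤ C)
    (hi2 : Integrable fun y => ‖y‖ ^ 2 * G y ^ 2) :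
    ∫ U, ‖zmCoord 1 U‖ ^ 2 * (Set.indicator {V : Cfg | ∀ e : Edge 3 1, 0 < scalarPart (V e)} (fun U : Cfg => G (gnCoord μ U)) U) ^ 2
        ∂(configMeasure SU2 1) ≤
      μ ^ 2 * (μ ^ 9 * ((2 * π ^ 2)⁻¹) ^ 3) * ∫ y, ‖y‖ ^ 2 * G y ^ 2 := by
  obtain ⟨C, hC⟩ := hb
  set φ := Set.indicator {V : Cfg | ∀ e : Edge 3 1, 0 < scalarPart (V e)} (fun U : Cfg => G (gnCoord μ U)) with hφ
  have hφm : Measurable φ := (hG.comp (measurable_gnCoord μ)).indicator measurableSet_upper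
  have hφb : ∀ U, |φ U| ≤ C := fun U => by
    rw [hφ, Set.indicator_apply]
    split_ifs
    · exact hC _
    · rw [abs_zero]; exact (abs_nonneg _).trans (hC 0)
  -- the weight is bounded by `3`
  have hzm : ∀ U : Cfg, ‖zmCoord 1 U‖ ^ 2 ≤ 3 := fun U => by
    rw [norm_zmCoord_one_sq]
    calc ∑ i : Fin 3, ∑ a : Fin 3, vecPart (U (edgeOf i)) a ^ 2 ≤ ∑ _i : Fin 3, (1 : ℝ) := Finset.sum_le_sum fun i _ => sum_vecPart_sq_le _
      _ = 3 := by simp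
  have hgm : Measurable fun U : Cfg => ‖zmCoord 1 U‖ ^ 2 * φ U ^ 2 :=
    ((continuous_zmCoord 1).norm.measurable.pow_const 2).mul (hφm.pow_const 2)
  have hgb : ∃ C' : ℝ, ∀ U : Cfg, |‖zmCoord 1 U‖ ^ 2 * φ U ^ 2| ≤ C' := ⟨3 * C ^ 2, fun U => by
    rw [abs_mul, abs_of_nonneg (sq_nonneg _), abs_of_nonneg (sq_nonneg _)]
    refine mul_le_mul (hzm U) ?_ (sq_nonneg _) (by norm_num)
    rw [← sq_abs]; exact pow_le_pow_left₀ (abs_nonneg _) (hφb U) 2⟩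
  rw [integral_configMeasure_eq_sum_gnChart hμ hgm hgb, Finset.sum_eq_single (fun _ : Fin 3 => false)]
  · have hc0 : 0 ≤ μ ^ 9 * ((2 * π ^ 2)⁻¹) ^ 3 := by positivity
    calc ∫ y, gnDensityReal μ y * (‖zmCoord 1 (gnChart μ (fun _ => false) y)‖ ^ 2 * φ (gnChart μ (fun _ => false) y) ^ 2)
        ≤ ∫ y, μ ^ 9 * ((2 * π ^ 2)⁻¹) ^ 3 * (μ ^ 2 * (‖y‖ ^ 2 * G y ^ 2)) := by
          refine integral_mono_of_nonneg (ae_of_all _ fun y => ?_) ((hi2.const_mul _).const_mul _) (ae_of_all _ fun y => ?_)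
          · exact mul_nonneg (gnDensityReal_pos hμ y).le (by positivity)
          · have h1 : φ (gnChart μ (fun _ => false) y) = G y := by
              rw [hφ, indicator_upper_gnChart μ, if_pos rfl, gnCoord_gnChart hμ.ne']
            show gnDensityReal μ y * (‖zmCoord 1 (gnChart μ (fun _ => false) y)‖ ^ 2 * φ (gnChart μ (fun _ => false) y) ^ 2) ≤
              μ ^ 9 * ((2 * π ^ 2)⁻¹) ^ 3 * (μ ^ 2 * (‖y‖ ^ 2 * G y ^ 2))
            rw [h1]
            have h2 := norm_zmCoord_gnChart_sq_le hμ (fun _ => false) y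
            have h3 := gnDensityReal_le hμ y
            have h4 : ‖zmCoord 1 (gnChart μ (fun _ => false) y)‖ ^ 2 * G y ^ 2 ≤ μ ^ 2 * (‖y‖ ^ 2 * G y ^ 2) := by
              have := mul_le_mul_of_nonneg_right h2 (sq_nonneg (G y)); linarith
            exact mul_le_mul h3 h4 (by positivity) hc0
      _ = μ ^ 2 * (μ ^ 9 * ((2 * π ^ 2)⁻¹) ^ 3) * ∫ y, ‖y‖ ^ 2 * G y ^ 2 := by
          rw [integral_const_mul, integral_const_mul]; ring
  · intro σ _ hσ
    refine integral_eq_zero_of_ae (ae_of_all _ fun y => ?_)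
    have h1 : φ (gnChart μ σ y) = 0 := by rw [hφ, indicator_upper_gnChart μ, if_neg hσ]
    show gnDensityReal μ y * (‖zmCoord 1 (gnChart μ σ y)‖ ^ 2 * φ (gnChart μ σ y) ^ 2) = (0 : ZM → ℝ) y
    rw [h1, Pi.zero_apply]; ring
  · intro h; exact absurd (Finset.mem_univ _) h

end Quasimode

end Summit.QuantumFields.YangMills.Theorems.FemtoTransferGap

end
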